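import Mathlib
import Summits.NavierStokesRegularity.NavierStokesRegularity.Theorems.PlaneEnergyCeilingPlanarEnergyAPrioriLateBudget

/-!
# Route PlaneEnergyCeiling · crux `PlanarEnergyAPriori` ⇐ a subcritical late flux-oscillation rate

Helper file for the crux item stmt-NavierStokesRegularity-16855 (`PlanarEnergyAPriori`, route
`PlaneEnergyCeiling`), landed `--supports` that item. Composition of the landed reductions
`planarCeiling_of_lateBudget` (the budget is needed only on a final stretch) and
`fluxBudget_le_of_oscRate` (a subcritical oscillation rate closes the budget): THE CRUX FOLLOWS
FROM A SUBCRITICAL RATE OF THE BERNOULLI-FLUX OSCILLATION NEAR `T`. Precisely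
(`planarEnergyAPriori_of_lateOscRate`): if along every classical Leray–Hopf solution from a
rapidly decaying datum on `[0,T)` there are `T₁ ∈ [0,T)`, `A ≥ 0` and `α ∈ [0,1/2)` with

  `osc_{a,b} ‖F(s;R,a) − F(s;R,b)‖ₑ ≤ A (T − s)^{−α}`   for `s ∈ (T₁,T)` and every `R`,

then `PlaneEnergyCeiling.PlanarEnergyAPriori` holds. The self-similar (Type-I) rate is the
excluded borderline `α = 1/2`. Folklore bookkeeping over the landed pieces.
-/

noncomputable section

-- single-conjunct summit: `Summit.<Summit>.<Problem>` repeats the name by the D-0017 layout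
set_option linter.dupNamespace false

namespace Summit.NavierStokesRegularity.NavierStokesRegularity.Theorems.PlanarEnergyAPriori

open MeasureTheory Set Filter Topology Function WithLp Real
open scoped ENNReal RealInnerProductSpace
open Literature.Analysis.FluidPDE

variable {ν T : ℝ} {u : ℝ → EuclideanSpace ℝ (Fin 3) → EuclideanSpace ℝ (Fin 3)} {p : ℝ → EuclideanSpace ℝ (Fin 3) → ℝ}

/-- **A subcritical late oscillation rate bounds the late budget**: for an abstract oscillation
`O` with `O(s) ≤ A(T − s)^{−α}` on `(T₁,T)`, `0 ≤ α < 1/2`, `A ≥ 0`, `0 ≤ T₁`, and every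
`t ∈ [T₁,T)`: `∫⁻_{(T₁,t)} ofReal((√(πν(t−s)))⁻¹) O(s) ≤ ofReal((√(πν))⁻¹ A T^{1/2−α}/(1/2−α))`. -/
theorem lateBudget_le_of_lateOscRate {A α T₁ : ℝ} (hν : 0 < ν) (hA : 0 ≤ A) (hα0 : 0 ≤ α) (hα : α < 1 / 2)
    (hT₁ : 0 ≤ T₁) {O : ℝ → ℝ≥0∞} (hosc : ∀ s ∈ Ioo T₁ T, O s ≤ ENNReal.ofReal (A * (T - s) ^ (-α)))
    {t : ℝ} (ht : t ∈ Ico T₁ T) :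
    ∫⁻ s in Ioo T₁ t, ENNReal.ofReal ((Real.sqrt (π * ν * (t - s)))⁻¹) * O s ≤
      ENNReal.ofReal ((Real.sqrt (π * ν))⁻¹ * A * T ^ (1 / 2 - α) / (1 / 2 - α)) := by
  classical
  -- cut the oscillation off before `T₁`
  set O' : ℝ → ℝ≥0∞ := fun s => if T₁ < s then O s else 0 with hO'
  have hosc' : ∀ s ∈ Ioo 0 T, O' s ≤ ENNReal.ofReal (A * (T - s) ^ (-α)) := fun s hs => by
    by_cases h : T₁ < s
    · simp only [hO', h, if_true]; exact hosc s ⟨h, hs.2⟩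
    · simp only [hO', h, if_false]; exact bot_le
  calc ∫⁻ s in Ioo T₁ t, ENNReal.ofReal ((Real.sqrt (π * ν * (t - s)))⁻¹) * O s
      = ∫⁻ s in Ioo T₁ t, ENNReal.ofReal ((Real.sqrt (π * ν * (t - s)))⁻¹) * O' s :=
        setLIntegral_congr_fun measurableSet_Ioo fun s hs => by simp only [hO', hs.1, if_true]
    _ ≤ ∫⁻ s in Ioo 0 t, ENNReal.ofReal ((Real.sqrt (π * ν * (t - s)))⁻¹) * O' s :=
        lintegral_mono_set (Ioo_subset_Ioo_left hT₁)
    _ ≤ _ := fluxBudget_le_of_oscRate hν hA hα0 hα hosc' ⟨hT₁.trans ht.1, ht.2⟩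

/-- **Per-solution planar ceiling from a subcritical late oscillation rate.** [folklore] -/
theorem planarCeiling_of_lateOscRate (hν : 0 < ν) (hT : 0 < T) (hcl : IsClassicalNSSolutionOn (Ico 0 T) ν 0 u p)
    (hLH : IsLerayHopfOn T ν 0 (u 0) u) (hdec : HasRapidSpatialDecay (u 0)) {T₁ A α : ℝ} (hT₁ : T₁ ∈ Ico 0 T)
    (hA : 0 ≤ A) (hα0 : 0 ≤ α) (hα : α < 1 / 2)
    (hosc : ∀ s ∈ Ioo T₁ T, ∀ (R : EuclideanSpace ℝ (Fin 3) ≃ₗᵢ[ℝ] EuclideanSpace ℝ (Fin 3)),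
      (⨆ (a : ℝ) (b : ℝ), ‖(∫ y : EuclideanSpace ℝ (Fin 2), (‖u s (R (toLp 2 ![y 0, y 1, a]))‖ ^ 2 / 2 +
            p s (R (toLp 2 ![y 0, y 1, a]))) * ⟪u s (R (toLp 2 ![y 0, y 1, a])), R (EuclideanSpace.single 2 1)⟫) -
          ∫ y : EuclideanSpace ℝ (Fin 2), (‖u s (R (toLp 2 ![y 0, y 1, b]))‖ ^ 2 / 2 +
            p s (R (toLp 2 ![y 0, y 1, b]))) * ⟪u s (R (toLp 2 ![y 0, y 1, b])), R (EuclideanSpace.single 2 1)⟫‖ₑ) ≤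
        ENNReal.ofReal (A * (T - s) ^ (-α))) :
    ∃ M : ℝ, ∀ t ∈ Ico 0 T, ∀ (R : EuclideanSpace ℝ (Fin 3) ≃ₗᵢ[ℝ] EuclideanSpace ℝ (Fin 3)) (c : ℝ),
      ∫⁻ y : EuclideanSpace ℝ (Fin 2), ‖u t (R (toLp 2 ![y 0, y 1, c]))‖ₑ ^ 2 ≤ ENNReal.ofReal M :=
  planarCeiling_of_lateBudget hν hT hcl hLH hdec hT₁
    (B := (Real.sqrt (π * ν))⁻¹ * A * T ^ (1 / 2 - α) / (1 / 2 - α))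
    fun _ ht R => lateBudget_le_of_lateOscRate hν hA hα0 hα hT₁.1 (fun s hs => hosc s hs R) ht

/-- **`PlanarEnergyAPriori ⇐ a subcritical late flux-oscillation rate`, the route declaration
BY NAME**: if along every classical Leray–Hopf solution from a rapidly decaying datum on `[0,T)`
the Bernoulli-flux oscillation obeys `osc F(s;R,·) ≤ A(T−s)^{−α}` on a final stretch with some
`α < 1/2`, then the crux holds (the Type-I rate `α = 1/2` is the excluded borderline). [folklore] -/
theorem planarEnergyAPriori_of_lateOscRate
    (h : ∀ (ν T : ℝ), 0 < ν → 0 < T → ∀ (u : ℝ → EuclideanSpace ℝ (Fin 3) → EuclideanSpace ℝ (Fin 3))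
      (p : ℝ → EuclideanSpace ℝ (Fin 3) → ℝ), IsClassicalNSSolutionOn (Ico 0 T) ν 0 u p →
      IsLerayHopfOn T ν 0 (u 0) u → HasRapidSpatialDecay (u 0) →
      ∃ T₁ ∈ Ico 0 T, ∃ A : ℝ, ∃ α : ℝ, 0 ≤ A ∧ 0 ≤ α ∧ α < 1 / 2 ∧
        ∀ s ∈ Ioo T₁ T, ∀ (R : EuclideanSpace ℝ (Fin 3) ≃ₗᵢ[ℝ] EuclideanSpace ℝ (Fin 3)),
          (⨆ (a : ℝ) (b : ℝ), ‖(∫ y : EuclideanSpace ℝ (Fin 2), (‖u s (R (toLp 2 ![y 0, y 1, a]))‖ ^ 2 / 2 +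
                p s (R (toLp 2 ![y 0, y 1, a]))) * ⟪u s (R (toLp 2 ![y 0, y 1, a])), R (EuclideanSpace.single 2 1)⟫) -
              ∫ y : EuclideanSpace ℝ (Fin 2), (‖u s (R (toLp 2 ![y 0, y 1, b]))‖ ^ 2 / 2 +
                p s (R (toLp 2 ![y 0, y 1, b]))) * ⟪u s (R (toLp 2 ![y 0, y 1, b])), R (EuclideanSpace.single 2 1)⟫‖ₑ) ≤
            ENNReal.ofReal (A * (T - s) ^ (-α))) :
    Summit.NavierStokesRegularity.NavierStokesRegularity.Theses.PlaneEnergyCeiling.PlanarEnergyAPriori := by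
  intro ν T hν hT u p hcl hLH hdec
  obtain ⟨T₁, hT₁, A, α, hA, hα0, hα, hosc⟩ := h ν T hν hT u p hcl hLH hdec
  exact planarCeiling_of_lateOscRate hν hT hcl hLH hdec hT₁ hA hα0 hα hosc

/-- **`PlanarEnergyAPriori ⇐ a subcritical late flux-oscillation rate`, registered expanded form**
(sub-goal `planarEnergyAPriori_of_lateOscRate_expanded` of stmt-NavierStokesRegularity-16855).
[folklore] -/
theorem planarEnergyAPriori_of_lateOscRate_expanded : (∀ (ν T : ℝ), 0 < ν → 0 < T → ∀ (u : ℝ → EuclideanSpace ℝ (Fin 3) → EuclideanSpace ℝ (Fin 3)) (p : ℝ → EuclideanSpace ℝ (Fin 3) → ℝ), Literature.Analysis.FluidPDE.IsClassicalNSSolutionOn (Set.Ico 0 T) ν 0 u p → Literature.Analysis.FluidPDE.IsLerayHopfOn T ν 0 (u 0) u → Literature.Analysis.FluidPDE.HasRapidSpatialDecay (u 0) → ∃ T₁ ∈ Set.Ico 0 T, ∃ A : ℝ, ∃ α : ℝ, 0 ≤ A ∧ 0 ≤ α ∧ α < 1 / 2 ∧ ∀ s ∈ Set.Ioo T₁ T,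 ∀ (R : EuclideanSpace ℝ (Fin 3) ≃ₗᵢ[ℝ] EuclideanSpace ℝ (Fin 3)), (⨆ (a : ℝ) (b : ℝ), ‖(∫ y : EuclideanSpace ℝ (Fin 2), (‖u s (R (WithLp.toLp 2 ![y 0, y 1, a]))‖ ^ 2 / 2 + p s (R (WithLp.toLp 2 ![y 0, y 1, a]))) * inner ℝ (u s (R (WithLp.toLp 2 ![y 0, y 1, a]))) (R (EuclideanSpace.single 2 1))) - (∫ y : EuclideanSpace ℝ (Fin 2), (‖u s (R (WithLp.toLp 2 ![y 0, y 1, b]))‖ ^ 2 / 2 + p s (R (WithLp.toLp 2 ![y 0, y 1, b]))) * inner ℝ (u s (R (WithLp.toLp 2 ![y 0, y 1, b]))) (R (EuclideanSpace.single 2 1)))‖ₑ) ≤ ENNReal.ofReal (A * (T - s) ^ (-α))) → ∀ (ν T : ℝ), 0 < ν → 0 < T → ∀ (u : ℝ → EuclideanSpace ℝ (Fin 3) → EuclideanSpace ℝ (Fin 3)) (p : ℝ → EuclideanSpace ℝ (Fin 3) → ℝ), Literature.Analysis.FluidPDE.IsClassicalNSSolutionOn (Set.Ico 0 T) ν 0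 u p → Literature.Analysis.FluidPDE.IsLerayHopfOn T ν 0 (u 0) u → Literature.Analysis.FluidPDE.HasRapidSpatialDecay (u 0) → ∃ M : ℝ, ∀ t ∈ Set.Ico 0 T, ∀ (R : EuclideanSpace ℝ (Fin 3) ≃ₗᵢ[ℝ] EuclideanSpace ℝ (Fin 3)) (c : ℝ), ∫⁻ y : EuclideanSpace ℝ (Fin 2), ‖u t (R (WithLp.toLp 2 ![y 0, y 1, c]))‖ₑ ^ 2 ≤ ENNReal.ofReal M :=
  fun h => planarEnergyAPriori_of_lateOscRate h

end Summit.NavierStokesRegularity.NavierStokesRegularity.Theorems.PlanarEnergyAPriori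

end
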